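import Summits.QuantumAdvantage.QuantumAdvantage.Theorems.OddPrimeWalkSignatureBalance

/-!
# Register coordinates and data cells of the u-walk game (engine for item stmt-QuantumAdvantage-24199 `EndRegisterLawFive`)

Cell qa-qnc0, route OddPrimeWalk (support, rank 9); planner qa-qnc0-p2 g31 (ROUND-31 §2.1–§2.2, ARCHITECTURE 31, plan
`line31/PROOF-E.md`); prover qn-prover-3 g19.

§1 REGISTER COORDINATES (PROOF-E Step 0).  `regCount y u e = #{g : y_g(u) ∧ (g + wtPrefix u g) ≡ e (mod 3)}` (the label-`e` register
parity before reduction mod 2) and the win identity `ringWinU_iff_regCount`: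
`ringWinU c y u ↔ (V₀ + V₁ + V₂ + V_{e₀}) odd`, `e₀ = −(c + |u|) mod 3` the dead label (fired cuts are live iff their label is not `e₀`).
§2 DATA CELLS (PROOF-E Step 3).  The data of an input are its masked first `D` bits `hd D u`, its masked last `D` bits `tl D u` and the
values `fv φ u ∈ (ℤ/5)^L` of `L` linear forms.  Inside a cell `{hd = s, tl = t}` the inputs are parametrised by their middle bits
(`splice`, index type `MidIdx n D = {i // D ≤ i < n − D}`), the form values and the weight are affine in the middle bits, and the tree's
two-moduli bound `TwoModuli.abs_three_mul_card_cell_sub_card_le` (Literature, p703190) gives, for EVERY data value `(s, t, v)` and every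
residue `b`:  `|3·#{data = (s,t,v), |u| ≡ b (3)} − #{data = (s,t,v)}| ≤ 2·(2cos(π/15))^(n − 2D)` (`three_mul_card_dataCell_sub_le`).
WHAT THIS IS NOT: instrument; separation NOT moved.
-/

namespace Summit.QuantumAdvantage.AdviceFreeQNC0.OddConfig

open Finset Classical Literature.Computability.MetaComplexity

variable {n : ℕ}

/-! ### §1 Register coordinates: the win bit from the three label counts -/

/-- the label-`e` register count `V_e(u) = #{g : y_g(u) = 1 ∧ (g + wtPrefix u g) % 3 = e}`. -/
def regCount (y : Fin (n + 1) → (Fin n → Bool) → Bool) (u : Fin n → Bool) (e : ℕ) : ℕ :=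
  (univ.filter fun g : Fin (n + 1) => y g u = true ∧ (g.val + wtPrefix u g.val) % 3 = e).card

/-- the number of fired cuts is the sum of the three label counts. -/
theorem card_fired_eq (y : Fin (n + 1) → (Fin n → Bool) → Bool) (u : Fin n → Bool) :
    (univ.filter fun g : Fin (n + 1) => y g u = true).card = regCount y u 0 + regCount y u 1 + regCount y u 2 := by
  rw [card_eq_sum_card_fiberwise (f := fun g : Fin (n + 1) => (g.val + wtPrefix u g.val) % 3) (t := range 3)
    (fun g _ => mem_range.mpr (Nat.mod_lt _ (by norm_num)))]
  simp only [sum_range_succ, sum_range_zero, zero_add, filter_filter, regCount]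

/-- **PROOF-E Step 0**: `ringWinU c y u ↔ V₀ + V₁ + V₂ + V_{e₀}` is odd, with `e₀ = (3 − (c + |u|) % 3) % 3` the dead label. -/
theorem ringWinU_iff_regCount (c : ℕ) (y : Fin (n + 1) → (Fin n → Bool) → Bool) (u : Fin n → Bool) :
    ringWinU c y u = true ↔
      (regCount y u 0 + regCount y u 1 + regCount y u 2 + regCount y u ((3 - (c + wt u) % 3) % 3)) % 2 = 1 := by
  set e₀ := (3 - (c + wt u) % 3) % 3 with he₀
  have hlive : (univ.filter fun g : Fin (n + 1) => y g u = true ∧ (c + g.val + walkExp u g.val) % 3 ≠ 0)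
      = (univ.filter fun g : Fin (n + 1) => y g u = true).filter
          fun g => ¬ (g.val + wtPrefix u g.val) % 3 = e₀ := by
    ext g
    simp only [mem_filter, mem_univ, true_and, walkExp]
    constructor
    · rintro ⟨h1, h2⟩; exact ⟨h1, by omega⟩
    · rintro ⟨h1, h2⟩; exact ⟨h1, by omega⟩
  have hsplit := card_filter_add_card_filter_not (s := univ.filter fun g : Fin (n + 1) => y g u = true)
    (fun g => (g.val + wtPrefix u g.val) % 3 = e₀)
  have he : ((univ.filter fun g : Fin (n + 1) => y g u = true).filter fun g => (g.val + wtPrefix u g.val) % 3 = e₀).card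
      = regCount y u e₀ := by
    rw [filter_filter]; rfl
  rw [he, card_fired_eq] at hsplit
  unfold ringWinU
  rw [decide_eq_true_iff, hlive]
  constructor <;> intro h <;> omega

/-! ### §2 Data cells: the middle bits parametrise a cell, forms and weight are affine in them -/

section Cells

variable {D L : ℕ}

/-- the masked first `D` bits. -/
def hd (D : ℕ) (u : Fin n → Bool) : Fin n → Bool := fun i => decide (i.val < D) && u i

/-- the masked last `D` bits. -/
def tl (D : ℕ) (u : Fin n → Bool) : Fin n → Bool := fun i => decide (n ≤ i.val + D) && u i

/-- the values of the `L` linear forms mod `5`. -/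
def fv (φ : Fin L → Fin n → ZMod 5) (u : Fin n → Bool) : Fin L → ZMod 5 := fun k => ∑ i : Fin n, if u i = true then φ k i else 0

/-- the middle positions `D ≤ i < n − D`. -/
abbrev MidIdx (n D : ℕ) : Type := {i : Fin n // D ≤ i.val ∧ i.val + D < n}

/-- the number of middle positions is `n − 2D` (when `2D ≤ n`). -/
theorem card_midIdx (hD : 2 * D ≤ n) : Fintype.card (MidIdx n D) = n - 2 * D := by
  rw [Fintype.card_subtype]
  have e : (univ.filter fun i : Fin n => D ≤ i.val ∧ i.val + D < n) = ivl n D (n - 2 * D) := by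
    ext i; simp only [mem_filter, mem_univ, true_and, ivl]; omega
  rw [e, card_ivl (by omega)]

/-- splice middle bits `z` into the outside bits of `u₀`. -/
def splice (D : ℕ) (u₀ : Fin n → Bool) (z : MidIdx n D → Bool) : Fin n → Bool :=
  fun i => if h : D ≤ i.val ∧ i.val + D < n then z ⟨i, h⟩ else u₀ i

/-- restriction to the middle bits. -/
def resM (D : ℕ) (u : Fin n → Bool) : MidIdx n D → Bool := fun j => u j.1

/-- `resM ∘ splice = id`. -/
theorem resM_splice (u₀ : Fin n → Bool) (z : MidIdx n D → Bool) : resM D (splice D u₀ z) = z := by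
  funext j; simp [resM, splice, j.2]

/-- two inputs with the same data agree outside the middle. -/
theorem eq_off_mid {u u₀ : Fin n → Bool} (hs : hd D u = hd D u₀) (ht : tl D u = tl D u₀) {i : Fin n}
    (hi : ¬ (D ≤ i.val ∧ i.val + D < n)) : u i = u₀ i := by
  by_cases h1 : i.val < D
  · have := congrFun hs i; simpa [hd, h1] using this
  · have h2 : n ≤ i.val + D := by omega
    have := congrFun ht i; simpa [tl, h2] using this

/-- `splice ∘ resM = id` on the cell of `u₀`. -/
theorem splice_resM {u u₀ : Fin n → Bool} (hs : hd D u = hd D u₀) (ht : tl D u = tl D u₀) :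
    splice D u₀ (resM D u) = u := by
  funext i
  by_cases h : D ≤ i.val ∧ i.val + D < n
  · simp [splice, resM, h]
  · simp only [splice, h, dif_neg, not_false_eq_true]; exact (eq_off_mid hs ht h).symm

/-- splicing does not change the head data. -/
theorem hd_splice (u₀ : Fin n → Bool) (z : MidIdx n D → Bool) : hd D (splice D u₀ z) = hd D u₀ := by
  funext i
  by_cases h1 : i.val < D
  · have h : ¬ (D ≤ i.val ∧ i.val + D < n) := by omega
    simp [hd, splice, h, h1]
  · simp [hd, h1]

/-- splicing does not change the tail data. -/
theorem tl_splice (u₀ : Fin n → Bool) (z : MidIdx n D → Bool) : tl D (splice D u₀ z) = tl D u₀ := by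
  funext i
  by_cases h1 : n ≤ i.val + D
  · have h : ¬ (D ≤ i.val ∧ i.val + D < n) := by omega
    simp [tl, splice, h, h1]
  · simp [tl, h1]

/-- a sum over `Fin n` splits into the middle part (indexed by `MidIdx`) and the outside part. -/
theorem sum_split_mid {M : Type*} [AddCommMonoid M] (f : Fin n → M) :
    (∑ i : Fin n, f i) = (∑ j : MidIdx n D, f j.1) + ∑ i ∈ univ.filter (fun i : Fin n => ¬ (D ≤ i.val ∧ i.val + D < n)), f i := by
  rw [← sum_filter_add_sum_filter_not univ (fun i : Fin n => D ≤ i.val ∧ i.val + D < n) f]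
  congr 1
  exact (sum_subtype (univ.filter fun i : Fin n => D ≤ i.val ∧ i.val + D < n) (fun i => by simp) f)

/-- the outside contribution of `u₀` to the form values. -/
def fvOut (D : ℕ) (φ : Fin L → Fin n → ZMod 5) (u₀ : Fin n → Bool) : Fin L → ZMod 5 :=
  fun k => ∑ i ∈ univ.filter (fun i : Fin n => ¬ (D ≤ i.val ∧ i.val + D < n)), if u₀ i = true then φ k i else 0

/-- the outside weight of `u₀`. -/
def wtOut (D : ℕ) (u₀ : Fin n → Bool) : ℕ :=
  ((univ.filter fun i : Fin n => ¬ (D ≤ i.val ∧ i.val + D < n)).filter fun i => u₀ i = true).card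

/-- **forms are affine in the middle bits**: `fv φ (splice u₀ z) = fvOut u₀ + (cube form of z)`. -/
theorem fv_splice (φ : Fin L → Fin n → ZMod 5) (u₀ : Fin n → Bool) (z : MidIdx n D → Bool) :
    fv φ (splice D u₀ z) = fun k => fvOut D φ u₀ k + ∑ j : MidIdx n D, if z j = true then φ k j.1 else 0 := by
  funext k
  unfold fv fvOut
  rw [sum_split_mid (D := D), add_comm]
  congr 1
  · refine sum_congr rfl fun i hi => ?_
    have h := (mem_filter.mp hi).2
    simp [splice, h]
  · refine sum_congr rfl fun j _ => ?_
    simp [splice, j.2]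

/-- **the weight is affine in the middle bits**: `|splice u₀ z| = wtOut u₀ + #ones(z)`. -/
theorem wt_splice (u₀ : Fin n → Bool) (z : MidIdx n D → Bool) :
    wt (splice D u₀ z) = wtOut D u₀ + (univ.filter fun j : MidIdx n D => z j = true).card := by
  unfold wt wtOut
  rw [card_filter, card_filter, card_filter, sum_split_mid (D := D), add_comm]
  congr 1
  · refine sum_congr rfl fun i hi => ?_
    have h := (mem_filter.mp hi).2
    simp [splice, h]
  · refine sum_congr rfl fun j _ => ?_
    simp [splice, j.2]

/-- solving an affine equation between form-value vectors. -/
theorem fun_add_eq_iff (a S v : Fin L → ZMod 5) : (fun k => a k + S k) = v ↔ S = v - a := by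
  constructor
  · intro h; funext k; have hk : a k + S k = v k := congrFun h k; rw [Pi.sub_apply, ← hk]; ring
  · intro h; funext k; have hk : S k = v k - a k := by rw [h, Pi.sub_apply]
    rw [hk]; ring

/-- **the data cell transported to the middle cube**: for `u₀` in the cell `{hd = s, tl = t}` and any predicate `P`,
`#{u : hd u = s ∧ tl u = t ∧ P u} = #{z : P (splice u₀ z)}`. -/
theorem card_cell_eq (u₀ : Fin n → Bool) (P : (Fin n → Bool) → Prop) [DecidablePred P] :
    (univ.filter fun u : Fin n → Bool => hd D u = hd D u₀ ∧ tl D u = tl D u₀ ∧ P u).card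
      = (univ.filter fun z : MidIdx n D → Bool => P (splice D u₀ z)).card := by
  refine card_nbij' (resM D) (splice D u₀) ?_ ?_ ?_ ?_
  · intro u hu
    obtain ⟨hs, ht, hP⟩ := (mem_filter.mp (mem_coe.mp hu)).2
    refine mem_coe.mpr (mem_filter.mpr ⟨mem_univ _, ?_⟩)
    rw [splice_resM hs ht]; exact hP
  · intro z hz
    have hP := (mem_filter.mp (mem_coe.mp hz)).2
    exact mem_coe.mpr (mem_filter.mpr ⟨mem_univ _, hd_splice u₀ z, tl_splice u₀ z, hP⟩)
  · intro u hu
    obtain ⟨hs, ht, _⟩ := (mem_filter.mp (mem_coe.mp hu)).2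
    exact splice_resM hs ht
  · intro z _; exact resM_splice u₀ z

/-- residues in `ℕ` versus `ZMod 3` for an affine weight. -/
theorem mod_three_affine_iff (w m : ℕ) {b : ℕ} (hb : b < 3) :
    (w + m) % 3 = b ↔ ((m : ℕ) : ZMod 3) = (b : ZMod 3) - (w : ZMod 3) := by
  rw [eq_sub_iff_add_eq, ← Nat.cast_add, add_comm, ZMod.natCast_eq_natCast_iff', Nat.mod_eq_of_lt hb]

/-- **EQUIDISTRIBUTION OF THE CLASS IN EVERY DATA CELL (PROOF-E Step 3).**  For `2D ≤ n`, every data value `(s, t, v)` and every `b < 3`: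
`|3·#{hd u = s ∧ tl u = t ∧ fv φ u = v ∧ |u| ≡ b} − #{hd u = s ∧ tl u = t ∧ fv φ u = v}| ≤ 2·(2cos(π/15))^(n − 2D)`. -/
theorem three_mul_card_dataCell_sub_le (hD : 2 * D ≤ n) (φ : Fin L → Fin n → ZMod 5)
    (s t : Fin n → Bool) (v : Fin L → ZMod 5) {b : ℕ} (hb : b < 3) :
    |3 * ((univ.filter fun u : Fin n → Bool => hd D u = s ∧ tl D u = t ∧ fv φ u = v ∧ wt u % 3 = b).card : ℝ)
        - ((univ.filter fun u : Fin n → Bool => hd D u = s ∧ tl D u = t ∧ fv φ u = v).card : ℝ)|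
      ≤ 2 * (2 * Real.cos (Real.pi / 15)) ^ (n - 2 * D) := by
  by_cases hne : ∃ u₀ : Fin n → Bool, hd D u₀ = s ∧ tl D u₀ = t
  · obtain ⟨u₀, hs₀, ht₀⟩ := hne
    -- transport both counts to the middle cube
    have h1 : (univ.filter fun u : Fin n → Bool => hd D u = s ∧ tl D u = t ∧ fv φ u = v ∧ wt u % 3 = b).card
        = (univ.filter fun z : MidIdx n D → Bool =>
            ((univ.filter fun j => z j = true).card : ZMod 3) = (b : ZMod 3) - (wtOut D u₀ : ZMod 3) ∧
            (fun k => ∑ j : MidIdx n D, if z j = true then φ k j.1 else 0) = v - fvOut D φ u₀).card := by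
      rw [← hs₀, ← ht₀, card_cell_eq u₀ (fun u => fv φ u = v ∧ wt u % 3 = b)]
      refine congrArg Finset.card (filter_congr fun z _ => ?_)
      rw [fv_splice, wt_splice, mod_three_affine_iff _ _ hb, fun_add_eq_iff, and_comm]
    have h2 : (univ.filter fun u : Fin n → Bool => hd D u = s ∧ tl D u = t ∧ fv φ u = v).card
        = (univ.filter fun z : MidIdx n D → Bool =>
            (fun k => ∑ j : MidIdx n D, if z j = true then φ k j.1 else 0) = v - fvOut D φ u₀).card := by
      rw [← hs₀, ← ht₀, card_cell_eq u₀ (fun u => fv φ u = v)]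
      refine congrArg Finset.card (filter_congr fun z _ => ?_)
      rw [fv_splice, fun_add_eq_iff]
    have hlit := TwoModuli.abs_three_mul_card_cell_sub_card_le (ι := MidIdx n D) (p := 5) (K := L) (by norm_num)
      (fun k (j : MidIdx n D) => φ k j.1) (v - fvOut D φ u₀) ((b : ZMod 3) - (wtOut D u₀ : ZMod 3))
    rw [two_cos_fifteen_eq, card_midIdx hD, ← h1, ← h2] at hlit
    exact hlit
  · -- empty cell
    have h0 : ∀ (P : (Fin n → Bool) → Prop) [DecidablePred P],
        (univ.filter fun u : Fin n → Bool => hd D u = s ∧ tl D u = t ∧ P u).card = 0 := by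
      intro P _
      rw [card_eq_zero, filter_eq_empty_iff]
      intro u _ h
      exact hne ⟨u, h.1, h.2.1⟩
    rw [h0 (fun u => fv φ u = v ∧ wt u % 3 = b), h0 (fun u => fv φ u = v)]
    simp only [Nat.cast_zero, mul_zero, sub_zero, abs_zero]
    have : 0 ≤ Real.cos (Real.pi / 15) := cos_pi_div_fifteen_nonneg
    positivity

end Cells

end Summit.QuantumAdvantage.AdviceFreeQNC0.OddConfig
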